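import Summits.Ventures.PercRepro.C041TriDomExcessZero

/-!
# ROW C-041 — THE EQUALITY CASE OF THE EXCESS, III: MARKS JOINED BY DOUBLE EDGES (p6, gen 43; §53 ADDENDUM 10)

The degenerate case of the status form: two marks connected by DOUBLE edges (contracted edges, present in both
colours — the status-model form of coincident marks) are connected in every colouring in both colours, so every
colouring contributes `0` (`Fsym_zero_coinc_first` / `_second` / `_third`) and `esym st = 0`
(`esym_eq_zero_of_dconn`).  Together with `esym_eq_zero_of_separable` this is the full «separable or degenerate ⟹
`esym = 0`» statement for statuses (`esym_eq_zero_of_separable'`).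
-/

namespace PercRepro

namespace ZoneZ

namespace MultiExit

open ZoneData Finset

variable {V₁ E₁ U₁ U₂ : Type} (Z₁ : ZoneData V₁ E₁ U₁ U₂) (u u' a₁ : V₁)

/-- The edge `e` is double (contracted) under the status `st`. -/
def dblE (st : E₁ → EStat) (e : E₁) : Prop := st e = .double

/-- `v` is connected to `k` by double edges. -/
def DConn (st : E₁ → EStat) (k v : V₁) : Prop := v ∈ ZoneData.reach (AdjCol Z₁ (dblE st)) {k}

/-- A double edge is red in every colouring. -/
theorem redE_of_dblE {st : E₁ → EStat} {e : E₁} (h : dblE st e) (ω : E₁ → Bool) : redE st ω e := Or.inl h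

/-- A double edge is blue in every colouring. -/
theorem blueE_of_dblE {st : E₁ → EStat} {e : E₁} (h : dblE st e) (ω : E₁ → Bool) : blueE st ω e := Or.inl h

/-- Double connectivity gives red connectivity in every colouring. -/
theorem RdS_of_dconn {st : E₁ → EStat} {k v : V₁} (h : DConn Z₁ st k v) (ω : E₁ → Bool) : RdS Z₁ st ω k v :=
  reach_mono (fun x y hxy => AdjCol_mono Z₁ (fun _ he => redE_of_dblE he ω) x y hxy) h

/-- Double connectivity gives blue connectivity in every colouring. -/
theorem MgS_of_dconn {st : E₁ → EStat} {k v : V₁} (h : DConn Z₁ st k v) (ω : E₁ → Bool) : MgS Z₁ st ω k v :=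
  reach_mono (fun x y hxy => AdjCol_mono Z₁ (fun _ he => blueE_of_dblE he ω) x y hxy) h

/-- Coincident exits: `Fsym` vanishes. -/
theorem Fsym_zero_coinc_third : ∀ s t : P3, s.2.2 = true → t.2.2 = true → Fsym s t = 0 := by
  decide

open Classical in
/-- Two marks joined by double edges: every colouring contributes `0`. -/
theorem Fsym_eq_zero_of_dconn (st : E₁ → EStat)
    (h : DConn Z₁ st a₁ u ∨ DConn Z₁ st a₁ u' ∨ DConn Z₁ st u u') (ω : E₁ → Bool) :
    Fsym (rsig Z₁ u u' a₁ st ω) (bsig Z₁ u u' a₁ st ω) = 0 := by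
  rcases h with h | h | h
  · refine Fsym_zero_coinc_first _ _ ?_ ?_
    · rw [rsig_fst]; exact decide_eq_true (RdS_of_dconn Z₁ h ω)
    · rw [bsig_fst]; exact decide_eq_true (MgS_of_dconn Z₁ h ω)
  · refine Fsym_zero_coinc_second _ _ ?_ ?_
    · rw [rsig_snd]; exact decide_eq_true (RdS_of_dconn Z₁ h ω)
    · rw [bsig_snd]; exact decide_eq_true (MgS_of_dconn Z₁ h ω)
  · refine Fsym_zero_coinc_third _ _ ?_ ?_
    · rw [rsig_thd]; exact decide_eq_true (RdS_of_dconn Z₁ h ω)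
    · rw [bsig_thd]; exact decide_eq_true (MgS_of_dconn Z₁ h ω)

variable [DecidableEq E₁] [Fintype E₁]

open Classical in
/-- **TWO MARKS JOINED BY DOUBLE EDGES ⟹ `esym = 0`.** -/
theorem esym_eq_zero_of_dconn (st : E₁ → EStat)
    (h : DConn Z₁ st a₁ u ∨ DConn Z₁ st a₁ u' ∨ DConn Z₁ st u u') : esym Z₁ u u' a₁ st = 0 := by
  unfold esym
  exact Finset.sum_eq_zero fun ω _ => Fsym_eq_zero_of_dconn Z₁ u u' a₁ st h ω

/-- **SEPARABLE OR DEGENERATE ⟹ `esym = 0`**, the full status form. -/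
theorem esym_eq_zero_of_separable' (st : E₁ → EStat)
    (h : SeparableS Z₁ u u' a₁ st ∨ DConn Z₁ st a₁ u ∨ DConn Z₁ st a₁ u' ∨ DConn Z₁ st u u') :
    esym Z₁ u u' a₁ st = 0 := by
  rcases h with h | h
  · exact esym_eq_zero_of_separable Z₁ u u' a₁ st h
  · exact esym_eq_zero_of_dconn Z₁ u u' a₁ st h

end MultiExit

end ZoneZ

end PercRepro
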